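import Summits.AtomisticToContinuum.Crystallization.Theorems.FreeSplittingCertificatesStrictSplittingRuleP1NearReduction
import Summits.AtomisticToContinuum.Crystallization.Theorems.FreeSplittingCertificatesStrictSplittingRuleP1TwoSiteLedger

/-!
# `StrictSplittingRule` (stmt-AtomisticToContinuum-12560): THE ENDPOINT — H12⋆ `CoreJointCoercive a h κ₁ κ₃` from the certificates (P1 interpolant object, part 60)

Route `FreeSplittingCertificates`, crux r3 `StrictSplittingRule` (H12⋆ = `stub_coreJointCoercive`), unit b2b-freesplit-B gen 33.
VALUE = the CONDITIONAL KERNEL CLOSURE of H12⋆ announced in HOME FAR-LEMMA-SPEC §23 (b) ("ENDPOINT"): **`coreJointCoercive_of_certificates`** —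
`CoreJointCoercive a h κ₁ κ₃` on the `HcpFamilyMin` box from a stencilled decaying first-order design `β` with H1's identity at the two sublattice
representatives, near tables `M₁, N` on `p1BondOffsets`, `M = M₁ + M_far`, and, PER REPRESENTATIVE `p ∈ {(0,0,0), (1,0,0)}`, explicit finite data
(far shares + allocation tables + routing + circumradii; first shell `SH`, reach set `QB` with tables `(L,U)`, transfer support `QT`, near legs `LEG`,
column sums `colβ`, payments `PAYM`, collar cells `CELLS`, flux enclosure `(QF, F₀, Δ)`) subject to exactly these CERTIFICATE-TIER statements:
  (B)   the per-cell readout + defect budget in dyad form (`hB`; HOME CERT §31, every cell);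
  (NC)  the finite near form is nonnegative on the least-squares constraint set (`hNC`; CERT §30 (3), "v9");
  (S)   per-site domination of the pair form by the hat-averaged far shares off `QB` (`hS`; CERT §29–§30 incl. the tail);
  (TAB) the hat-average tables on `QB` (`hTab`);  (PAY) the far table's column-sum enclosures (`hPAY`);  (FLX) the flux enclosure (`hFlux`; CERT §30 (1));
and the kernel-side bookkeeping hypotheses (`hSH`, `hQT`, `hwfar`, `hcol`, `hCELLS`) about the index sets.  Composition of `coreJointCoercive_of_ledgers`
(part 57) with `nearLedger_of_finite` (part 59).  The cell instantiates `κ₁ = 1/3`, `κ₃ = 1/12`, `κ = 193/125`, `(R₁,R₂) = (4.05, 5.4)a`, `β` = the landed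
line truss, with generated tables (G9b).  This theorem is NOT a proof of H12⋆: the six statements are hypotheses, verified OUTSIDE the kernel at the
python-exact / outward-rounded-interval tier (HOME CERT §29–§32).  NOT summit progress.  [folklore]
-/

noncomputable section

open Set Function Metric MeasureTheory Filter Topology
open scoped BigOperators NNReal ENNReal Classical

namespace Summit.AtomisticToContinuum.Crystallization.Theorems.StrictSplittingRuleBirth

open Literature.MathematicalPhysics.StatisticalMechanics
open Summit.AtomisticToContinuum.Crystallization.Theorems.PalmUnimodularRigidity.LayeredLawsSelectHcp

/-- **THE ENDPOINT: H12⋆ FROM THE CERTIFICATES.**  See the module docstring.  NOT a proof of H12⋆ ((B), (NC), (S), (TAB), (PAY), (FLX) are hypotheses verified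
outside the kernel), NOT summit progress. -/
theorem coreJointCoercive_of_certificates {a h κ₁ κ₃ : ℝ} (ha : 0 < a) (hh : 0 < h) (hfam : HcpFamilyMin a h)
    (Y₁ : Finset (ℤ × ℤ × ℤ)) (β : Bool → (ℤ × ℤ × ℤ) → (ℤ × ℤ × ℤ) → ℝ)
    (hY₁ : ∀ b d s, s ∉ Y₁ → β b d s = 0)
    {Cβ : ℝ} (hβ : ∀ p q : ℤ × ℤ × ℤ, ∀ s, |β (decide (Even p.1)) (q - p) s| ≤ Cβ * ((1 + ‖hcpSite a h q - hcpSite a h p‖)⁻¹) ^ 6)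
    (hH1 : ∀ u : ℤ × ℤ × ℤ → EuclideanSpace ℝ (Fin 3), (support u).Finite →
      ∀ p ∈ ({(0, 0, 0), (1, 0, 0)} : Finset (ℤ × ℤ × ℤ)),
        (∑' q : ℤ × ℤ × ℤ, (if q = p then (0 : ℝ) else
            ljSqDeriv (‖hcpSite a h q - hcpSite a h p‖ ^ 2) *
              inner ℝ (hcpSite a h q - hcpSite a h p) (u q - u p))) +
          (∑' q : ℤ × ℤ × ℤ, (if q = p then (0 : ℝ) else
            ∑ s ∈ Y₁, (β (decide (Even p.1)) (q - p) s *
                inner ℝ (hcpSite a h (p + s) - hcpSite a h p) (u (p + s) - u p) -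
              β (decide (Even q.1)) (p - q) s *
                inner ℝ (hcpSite a h (q + s) - hcpSite a h q) (u (q + s) - u q)))) = 0)
    (M₁ N M : Bool → (ℤ × ℤ × ℤ) → (ℤ × ℤ × ℤ) → (ℤ × ℤ × ℤ) → ℝ)
    (hMN₁ : ∀ b d s s', s ∉ p1BondOffsets ∨ s' ∉ p1BondOffsets → M₁ b d s s' = 0 ∧ N b d s s' = 0)
    {C₁ : ℝ} (hdec₁ : ∀ p q : ℤ × ℤ × ℤ, ∀ s s', |M₁ (decide (Even p.1)) (q - p) s s'| ≤
        C₁ * ((1 + ‖hcpSite a h q - hcpSite a h p‖)⁻¹) ^ 6 ∧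
      |N (decide (Even p.1)) (q - p) s s'| ≤ C₁ * ((1 + ‖hcpSite a h q - hcpSite a h p‖)⁻¹) ^ 6)
    {R1 R2 : ℝ} (hR1 : 0 < R1) (hR12 : R1 < R2) {κ : ℝ} (hκ : 0 ≤ κ)
    (hM : ∀ b e s s', M b e s s' = M₁ b e s s' + (fun b e s s' => if s = s' then -(κ * (2 / 5) / a ^ 4 * p1RecTable a h (p1SplitDensity R1 R2) b e s) else 0) b e s s')
    -- per representative: in-layer far shares and their allocation table
    (w : (ℤ × ℤ × ℤ) → (ℤ × ℤ × ℤ) × (ℤ × ℤ × ℤ) → ℝ) (hw : ∀ p e, 0 ≤ w p e)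
    (hws : ∀ p ∈ ({(0, 0, 0), (1, 0, 0)} : Finset (ℤ × ℤ × ℤ)),
      Summable fun e : (ℤ × ℤ × ℤ) × (ℤ × ℤ × ℤ) => w p e * fpSq (fun k => hcpSite a h (e.1 + e.2) k - hcpSite a h e.1 k))
    (θ : (ℤ × ℤ × ℤ) → (ℤ × ℤ × ℤ) × (ℤ × ℤ × ℤ) → (ℤ × ℤ × ℤ) × Fin 6 → ℝ) (hθ : ∀ p e T, 0 ≤ θ p e T)
    (hfinE : ∀ p e, (Function.support (θ p e)).Finite) (hfinC : ∀ p T, (Function.support fun e => θ p e T).Finite)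
    (hsum : ∀ p e, w p e ≠ 0 → ∑ᶠ T, θ p e T = 1)
    (hcar : ∀ p e T, θ p e T ≠ 0 → ∃ m m' : Fin 4, e.1 = T.1 + p1VertOff (p1Par T.1) T.2 m ∧
      e.1 + e.2 = T.1 + p1VertOff (p1Par T.1) T.2 m')
    -- per representative: vertical far shares, routing offsets and their allocation table
    (sv : (ℤ × ℤ × ℤ) → ℤ × ℤ × ℤ) (o : (ℤ × ℤ × ℤ) → (ℤ × ℤ × ℤ) → Fin 3 → ℤ × ℤ × ℤ) (S : Finset (ℤ × ℤ × ℤ))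
    (ho : ∀ p q i, o p q i ∈ S)
    (wv : (ℤ × ℤ × ℤ) → (ℤ × ℤ × ℤ) → ℝ) (hwv : ∀ p q, 0 ≤ wv p q) (hwvs : ∀ p, Summable (wv p))
    (θv : (ℤ × ℤ × ℤ) → (ℤ × ℤ × ℤ) × (ℤ × ℤ × ℤ) → (ℤ × ℤ × ℤ) × Fin 6 → ℝ) (hθv : ∀ p e T, 0 ≤ θv p e T)
    (hfinEv : ∀ p e, (Function.support (θv p e)).Finite) (hfinCv : ∀ p T, (Function.support fun e => θv p e T).Finite)
    (hsumv : ∀ p e, (∑ i : Fin 3, (2 / 3) * ((if e.2 = o p e.1 i then wv p e.1 else 0) +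
        (if o p (e.1 - (sv p - e.2)) i = sv p - e.2 then wv p (e.1 - (sv p - e.2)) else 0))) ≠ 0 → ∑ᶠ T, θv p e T = 1)
    (hcarv : ∀ p e T, θv p e T ≠ 0 → ∃ m m' : Fin 4, e.1 = T.1 + p1VertOff (p1Par T.1) T.2 m ∧
      e.1 + e.2 = T.1 + p1VertOff (p1Par T.1) T.2 m')
    -- per representative: circumradius data of the cells
    (cT : (ℤ × ℤ × ℤ) → (ℤ × ℤ × ℤ) × Fin 6 → Fin 3 → ℝ) (ρ : (ℤ × ℤ × ℤ) → (ℤ × ℤ × ℤ) × Fin 6 → ℝ)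
    (hρ : ∀ p i, ∀ m : Fin 4, fpSq (fun k => hcpSite a h (i.1 + p1VertOff (p1Par i.1) i.2 m) k - cT p i k) ≤ ρ p i)
    (ρ₀ : (ℤ × ℤ × ℤ) → ℝ) (hρ₀ : ∀ p i, |ρ p i| ≤ ρ₀ p)
    -- THE PER-CELL BUDGET (B) at each representative, dyad form, weights re-centred at `y_p`
    (hB : ∀ p ∈ ({(0, 0, 0), (1, 0, 0)} : Finset (ℤ × ℤ × ℤ)), ∀ (T : (ℤ × ℤ × ℤ) × Fin 6) (G : Fin 3 → Fin 3 → ℝ),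
      (∑ᶠ e : (ℤ × ℤ × ℤ) × (ℤ × ℤ × ℤ), θ p e T * w p e *
          fpSq (fun k => (hcpSite a h (e.1 + e.2) 0 - hcpSite a h e.1 0) * G 0 k +
            (hcpSite a h (e.1 + e.2) 1 - hcpSite a h e.1 1) * G 1 k + (hcpSite a h (e.1 + e.2) 2 - hcpSite a h e.1 2) * G 2 k)) +
      (∑ᶠ e : (ℤ × ℤ × ℤ) × (ℤ × ℤ × ℤ), θv p e T *
          (∑ i : Fin 3, (2 / 3) * ((if e.2 = o p e.1 i then wv p e.1 else 0) +
            (if o p (e.1 - (sv p - e.2)) i = sv p - e.2 then wv p (e.1 - (sv p - e.2)) else 0))) *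
          fpSq (fun k => (hcpSite a h (e.1 + e.2) 0 - hcpSite a h e.1 0) * G 0 k +
            (hcpSite a h (e.1 + e.2) 1 - hcpSite a h e.1 1) * G 1 k + (hcpSite a h (e.1 + e.2) 2 - hcpSite a h e.1 2) * G 2 k)) +
      (∫ y in p1RealCell a h T, κ * ((7 * (5 / 4 : ℝ) + 3 / 4) / 4) * fpChi (R1 ^ 2) (R2 ^ 2) (y - fun k => hcpSite a h p k) ^ 2 *
          (fpSq (y - fun k => hcpSite a h p k))⁻¹ ^ 4) * (ρ p T * fpFrob G) ≤
      κ * ((5 / 2 * (1 / 24 * fpSymSq G) + 5 / 2 * (1 / 24 * (fpFrob G - fpSymSq G))) *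
        ∫ y in p1RealCell a h T, fpChi (R1 ^ 2) (R2 ^ 2) (y - fun k => hcpSite a h p k) ^ 2 * (fpSq (y - fun k => hcpSite a h p k))⁻¹ ^ 3))
    -- PER REPRESENTATIVE: the explicit first shell
    (SH : (ℤ × ℤ × ℤ) → Finset (ℤ × ℤ × ℤ))
    (hSH : ∀ p ∈ ({(0, 0, 0), (1, 0, 0)} : Finset (ℤ × ℤ × ℤ)), ∀ q : ℤ × ℤ × ℤ,
      (0 < ‖hcpSite a h q - hcpSite a h p‖ ∧ ‖hcpSite a h q - hcpSite a h p‖ ≤ 11 / 10 * a) ↔ q ∈ SH p)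
    -- (S) per-site domination off the reach set, (TAB) the hat-average tables on it
    (QB : (ℤ × ℤ × ℤ) → Finset (ℤ × ℤ × ℤ)) (L U : (ℤ × ℤ × ℤ) → (ℤ × ℤ × ℤ) → ℝ)
    (hS : ∀ p ∈ ({(0, 0, 0), (1, 0, 0)} : Finset (ℤ × ℤ × ℤ)), ∀ q : ℤ × ℤ × ℤ, q ∉ QB p → q ≠ p → ∀ z : Fin 3 → ℝ,
      0 ≤ 1 / 2 * (ljSqDeriv (‖hcpSite a h q - hcpSite a h p‖ ^ 2) * fpSq z +
          2 * (1 / 2 * (7 * ((‖hcpSite a h q - hcpSite a h p‖ ^ 2)⁻¹) ^ 8 -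
            4 * ((‖hcpSite a h q - hcpSite a h p‖ ^ 2)⁻¹) ^ 5)) * p1NRad a h p (fun _ => z) q ^ 2) +
        p1SiteBare a h (fun y k l => κ * ((7 * (5 / 4 : ℝ) + 3 / 4) / 4) * fpChi (R1 ^ 2) (R2 ^ 2) (y - fun k => hcpSite a h p k) ^ 2 *
          (fpSq (y - fun k => hcpSite a h p k))⁻¹ ^ 5 * ((y - fun k => hcpSite a h p k) k * (y - fun k => hcpSite a h p k) l)) (fun _ => z) q -
        p1SiteBare a h (fun y k l => κ * ((3 / 4 : ℝ) / 4) * fpChi (R1 ^ 2) (R2 ^ 2) (y - fun k => hcpSite a h p k) ^ 2 *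
          (fpSq (y - fun k => hcpSite a h p k))⁻¹ ^ 4 * (if k = l then 1 else 0)) (fun _ => z) q)
    (hTab : ∀ p ∈ ({(0, 0, 0), (1, 0, 0)} : Finset (ℤ × ℤ × ℤ)), ∀ q ∈ QB p, q ≠ p → ∀ z : Fin 3 → ℝ,
      L p q * p1NRad a h p (fun _ => z) q ^ 2 ≤
        p1SiteBare a h (fun y k l => κ * ((7 * (5 / 4 : ℝ) + 3 / 4) / 4) * fpChi (R1 ^ 2) (R2 ^ 2) (y - fun k => hcpSite a h p k) ^ 2 *
          (fpSq (y - fun k => hcpSite a h p k))⁻¹ ^ 5 * ((y - fun k => hcpSite a h p k) k * (y - fun k => hcpSite a h p k) l)) (fun _ => z) q ∧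
      p1SiteBare a h (fun y k l => κ * ((3 / 4 : ℝ) / 4) * fpChi (R1 ^ 2) (R2 ^ 2) (y - fun k => hcpSite a h p k) ^ 2 *
          (fpSq (y - fun k => hcpSite a h p k))⁻¹ ^ 4 * (if k = l then 1 else 0)) (fun _ => z) q ≤ U p q * fpSq z)
    -- the near tables vanish off QT
    (QT : (ℤ × ℤ × ℤ) → Finset (ℤ × ℤ × ℤ))
    (hQT : ∀ p ∈ ({(0, 0, 0), (1, 0, 0)} : Finset (ℤ × ℤ × ℤ)), ∀ q : ℤ × ℤ × ℤ, q ∉ QT p → ∀ s s',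
      M₁ (decide (Even p.1)) (q - p) s s' = 0 ∧ M₁ (decide (Even q.1)) (p - q) s s' = 0 ∧
      N (decide (Even p.1)) (q - p) s s' = 0 ∧ N (decide (Even q.1)) (p - q) s' s = 0)
    -- the far shares take at least the full load off LEG
    (LEG : (ℤ × ℤ × ℤ) → Finset ((ℤ × ℤ × ℤ) × (ℤ × ℤ × ℤ)))
    (hwfar : ∀ p ∈ ({(0, 0, 0), (1, 0, 0)} : Finset (ℤ × ℤ × ℤ)), ∀ e : (ℤ × ℤ × ℤ) × (ℤ × ℤ × ℤ), e ∉ LEG p →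
      (if e.1 ≠ p ∧ e.2 ∈ Y₁ then 1 / 2 * β (decide (Even e.1.1)) (p - e.1) e.2 else 0) ≤ w p e + (if e.2 = sv p then wv p e.1 else 0))
    -- the column sums of β
    (colβ : (ℤ × ℤ × ℤ) → (ℤ × ℤ × ℤ) → ℝ)
    (hcol : ∀ p ∈ ({(0, 0, 0), (1, 0, 0)} : Finset (ℤ × ℤ × ℤ)), ∀ s ∈ Y₁,
      HasSum (fun q : ℤ × ℤ × ℤ => if q = p then (0 : ℝ) else β (decide (Even p.1)) (q - p) s) (colβ p s))
    -- (PAY) the far table's column-sum enclosures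
    (PAYM : (ℤ × ℤ × ℤ) → (ℤ × ℤ × ℤ) → ℝ)
    (hPAY : ∀ p ∈ ({(0, 0, 0), (1, 0, 0)} : Finset (ℤ × ℤ × ℤ)), ∀ s ∈ p1BondOffsets, κ * (2 / 5) / a ^ 4 *
      (∑' q : ℤ × ℤ × ℤ, p1RecTable a h (p1SplitDensity R1 R2) (decide (Even p.1)) (q - p) s) ≤ PAYM p s)
    -- the flux form vanishes off CELLS, (FLX) the flux enclosure
    (CELLS : (ℤ × ℤ × ℤ) → Finset ((ℤ × ℤ × ℤ) × Fin 6))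
    (hCELLS : ∀ p ∈ ({(0, 0, 0), (1, 0, 0)} : Finset (ℤ × ℤ × ℤ)), ∀ i, i ∉ CELLS p → ∀ Wv : Fin 4 → Fin 3 → ℝ,
      p1FluxQuad₀ (R1 ^ 2) (R2 ^ 2) (1 / 3) (4 / 3) (-9 / 8) (1 / 8) a h (fun k => hcpSite a h p k) i Wv = 0)
    (QF : (ℤ × ℤ × ℤ) → Finset (ℤ × ℤ × ℤ)) (FL0 : (ℤ × ℤ × ℤ) → (ℤ × ℤ × ℤ) × Fin 3 → (ℤ × ℤ × ℤ) × Fin 3 → ℝ)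
    (Δ : (ℤ × ℤ × ℤ) → (ℤ × ℤ × ℤ) → ℝ)
    (hFlux : ∀ p ∈ ({(0, 0, 0), (1, 0, 0)} : Finset (ℤ × ℤ × ℤ)), ∀ V : ℤ × ℤ × ℤ → (Fin 3 → ℝ),
      ∑ i ∈ CELLS p, p1FluxQuad₀ (R1 ^ 2) (R2 ^ 2) (1 / 3) (4 / 3) (-9 / 8) (1 / 8) a h (fun k => hcpSite a h p k) i (p1CellVals V i) ≤
        p1NearFlux (FL0 p) (Δ p) (QF p) V)
    -- (NC) THE NEAR CERTIFICATE on the least-squares constraint set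
    (hNC : ∀ p ∈ ({(0, 0, 0), (1, 0, 0)} : Finset (ℤ × ℤ × ℤ)), ∀ V : ℤ × ℤ × ℤ → (Fin 3 → ℝ), V p = 0 →
      (∀ Z : Fin 3 → Fin 3 → ℝ, (∀ j k, Z j k = -Z k j) →
        ∑ q ∈ SH p, ∑ k : Fin 3, V q k * (∑ j : Fin 3, (hcpSite a h q j - hcpSite a h p j) * Z j k) = 0) →
      0 ≤ p1NearForm a h κ₁ κ₃ κ p Y₁ β M₁ N (w p) (sv p) (wv p) (colβ p) (SH p) (QB p) (QT p) (QF p) (LEG p) (L p) (U p) (PAYM p) (Δ p) (FL0 p) V) :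
    CoreJointCoercive a h κ₁ κ₃ :=
  coreJointCoercive_of_ledgers ha hh hfam Y₁ β hY₁ hβ hH1 M₁ N M hMN₁ hdec₁ hR1 hR12 hκ hM w hw hws θ hθ hfinE hfinC hsum hcar
    sv o S ho wv hwv hwvs θv hθv hfinEv hfinCv hsumv hcarv cT ρ hρ ρ₀ hρ₀ hB
    fun p hp u hu W hWskew hWLS A hA =>
      nearLedger_of_finite ha hh Y₁ β hβ M₁ N hR1 hR12 hκ u hu p W hWskew hWLS A hA (w p) (hw p) (hws p hp) (sv p) (wv p) (hwv p) (hwvs p)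
        (SH p) (hSH p hp) (QB p) (L p) (U p) (hS p hp) (hTab p hp) (QT p) (hQT p hp) (LEG p) (hwfar p hp) (colβ p) (hcol p hp)
        (PAYM p) (hPAY p hp) (CELLS p) (hCELLS p hp) (QF p) (FL0 p) (Δ p) (hFlux p hp) (hNC p hp)

end Summit.AtomisticToContinuum.Crystallization.Theorems.StrictSplittingRuleBirth

end
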